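import Mathlib
import Summits.QuantumFields.YangMills.Theorems.BalabanUVNodesN15BackgroundLayerFirstOrderFull
import Summits.QuantumFields.YangMills.Theorems.BalabanUVNodesN15NonlinearCoefficient
import HarnessLib

/-!
# Route «BalabanUVNodes» (cluster K4 «SpineRates»), Track-A DAG node N15 = spine estimate NE2, BACKGROUND LAYER — «U LIVE» THROUGH THE EXPONENTIAL SPECIES
# (abelian scalar model of the covariant derivative): a GAUGE-FIELD carrier `A′` with the (3.35) letter pair, the first-order perturbation coefficients DERIVED
# from it by `phi1(η, ·) = η⁻¹(e^{η·} − 1)`, and their sup ∕ fit letters under the guard — the input of B1–B4's stacked first-order background layer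

Cell `pub-ymgap`, seat `pub-ymgap-dag-n15-b` (generation g5; FIRST-MISSING-ESTIMATE, HUMAN RULING D-0062; chair R424 venue; ROSTER-D0062 l.26).
`bears_on: R4∕N15`.  Filed `--supports stmt-QuantumFields-19676` (K3; helper).  Imports part B4 `…N15.BackgroundLayer` (and through it B1–B3: `stack`, `unstack`,
`hasMaj_unstack`, `hasMaj_idef_unstack`, `blkPair`, `liftPair`, `fineGeo`, `abs_blockAvg_le`) and g2's part 12c `…N15.CoefficientSpecies` (`phi1`, `phi1_lipschitz`,
`phi1_consistency`, `fit_nonlinear`) BY NAME; nothing in the tree is modified.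

THE POINT (ref-B READ-348: *«… and G(U) with U live»*).  Parts B2∕B4 take the first-order coefficients `(c′, a′_μ)` as the configuration.  In the print they are
FUNCTIONS OF THE BACKGROUND: [Balaban1985BackgroundPropagators] (3.50) p. 400, the covariant derivative `(D^η_Uλ)(b) = η⁻¹(R(U_b)λ(b₊) − λ(b₋))` with the
transport `R(U_b) = exp(iη ad_{A(b)})`, i.e. `D_U = M_R∘∇^η + M_{η⁻¹(R − 1)}` (part 18 `covD_apply`); in the ABELIAN SCALAR MODEL (`𝔤 = ℝ`, `R = e^{ηA}`) the
perturbation `V = D_U − ∇^η = Σ_μ [M_{η·phi1(η, A_μ)}∘∇_μ + M_{phi1(η, A_μ)}]` has coefficients `a_μ = η·phi1(η, A_μ)`, `c = Σ_μ phi1(η, A_μ)` — part 12c's species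
`phi1 η z = η⁻¹(e^{ηz} − 1)` with letters `K = e` (Lipschitz), `K′ = r²` (spacing consistency) on `ηr ≤ 1`.  THIS FILE: the gauge-field carrier `gaugeBg`
(`Cfg := A′ : J → X′ → ℝ`, `Reg335 c α₀ A′ :=` the (3.35) letter pair on every component), the DERIVED coefficients `gcoef`∕`gacoef` at both spacings (coarse field =
the block average of `A′` — the transport acts on the GAUGE FIELD, the coefficients are then NONLINEAR images, so the coarse coefficients are NOT block averages of
the fine ones), and `gauge_letters_of_reg335`: under the guard (`M ≥ 1`, `M·α₀ ≤ a₀`, `c₃₅a₀ ≤ 1` so `ηr ≤ 1`) and `η′ ≤ η ≤ min(1, θ)`, the unstacked perturbations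
have majorant `diagK (r₁(1+|J|))` and diagonal η-defect `diagK (r₁θ(1+|J|))` with the ONE letter `r₁ = (2e + 2)(1+|J|)·c₃₅Mα₀` — exactly B1a∕B3's perturbation letters.
The sequel (C2 `…BackgroundGaugeByName`) reads the four entries out by name.

CONTENTS ([folklore]; 4 defs).
* §1 `phi1_at_zero`, `abs_phi1_le` (`|phi1 s z| ≤ e|z|` on the box), `gcoef`∕`gacoef` (the derived coefficients), sup letters `abs_gcoef_le`∕`abs_gacoef_le`, fit
  letters `fit_gcoef`∕`fit_gacoef` (`fit_nonlinear` + `fit_blockAvg`; the `a`-fit pays `|η − η′|·e·r` for the spacing inside `R − 1`).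
* §2 `gaugeBg π J M θ : B9.Backgrounds`, `reg335_gaugeBg_iff`, `gavg`∕`gavg_zero`, `gaugePairing`, `gaugeInstance`, `gaugeInstance_M`.
* §3 **`gauge_letters_of_reg335`** — the perturbation letters of B1a∕B3 DISCHARGED from the gauge field's (3.35) letter pair.

HONEST FRAMING ∕ LIMITS.  ABELIAN SCALAR MODEL (`R = e^{ηA}` real; the print's `exp(iη ad_A)` is the matrix species of parts 13b∕18 — its operator-norm letters have
the same shape, the wiring through part 14's product carrier is not done here); one `phi1` per direction (the print's `F′_{1,k}`∕`phi2` second-order coefficient is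
part 12c∕13b's, not wired); linearised transport of the gauge field (block average); the `U ≡ 1` layer DISPLAYED downstream.  NE2⁺ NOT PRINTED, NOT proved;
count-neutral (typed 28∕28; nothing discharged); N15 NOT discharged; one finite lattice at fixed ε — NOT infinite volume, NOT OS on ℝ⁴, NOT a mass gap, NOT Clay.
-/

noncomputable section

open scoped BigOperators

namespace Summit.QuantumFields.YangMills.BalabanUVNodes.N15.BackgroundLayer

open Literature.MathematicalPhysics.QuantumFieldTheory.Balaban1983to89
open Literature.MathematicalPhysics.QuantumFieldTheory.Balaban1983to89.B11SectG (BlockNorm HasMaj)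
open Literature.MathematicalPhysics.QuantumFieldTheory.Balaban1983to89.T4EtaRate (PairedInstance EtaPairing)
open Literature.MathematicalPhysics.QuantumFieldTheory.Balaban1983to89.T4EtaRateDefect (idef)
open Literature.MathematicalPhysics.QuantumFieldTheory.Balaban1983to89.T4EtaRateCoeffDefect (pull diagK FibreOsc blockAvg fit_blockAvg)
open Summit.QuantumFields.YangMills.BalabanUVNodes.N15.CoefficientSpecies (phi1 phi1_zero phi1_lipschitz phi1_consistency fit_nonlinear)
open Summit.QuantumFields.YangMills.BalabanUVNodes.N15.OperatorReadout (opGeo)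

/-! ## §1 The exponential species as derived first-order coefficients, and their letters -/

section Species

variable {X X' J : Type} [Fintype J]

/-- `phi1 s 0 = 0`. [folklore] -/
theorem phi1_at_zero (s : ℝ) : phi1 s 0 = 0 := by
  unfold phi1; split_ifs <;> simp

/-- SIZE OF THE SPECIES: `|phi1 s z| ≤ e·|z|` for `0 ≤ s ≤ η₀`, `|z| ≤ r`, `η₀r ≤ 1` (Lipschitz against `z₂ = 0`). [folklore] -/
theorem abs_phi1_le {η₀ r s z : ℝ} (hreg : η₀ * r ≤ 1) (hr : 0 ≤ r) (hs0 : 0 ≤ s) (hs : s ≤ η₀) (hz : |z| ≤ r) :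
    |phi1 s z| ≤ Real.exp 1 * |z| := by
  have h := phi1_lipschitz hreg s hs0 hs z 0 hz (by simpa using hr)
  simpa [phi1_at_zero] using h

/-- THE DERIVED ZEROTH-ORDER COEFFICIENT `c = Σ_μ phi1(η, A_μ)` (the `M_{η⁻¹(R − 1)}` terms of `D_U − ∇`, abelian scalar model). [cite: Balaban1985BackgroundPropagators, (3.50) p.400 (covariant derivative: shape)] -/
def gcoef (η : ℝ) (A : J → X → ℝ) : X → ℝ := fun x => ∑ μ, phi1 η (A μ x)

/-- THE DERIVED FIRST-ORDER COEFFICIENTS `a_μ = η·phi1(η, A_μ) = R_μ − 1` (the `M_{R − 1}∘∇_μ` terms). [cite: Balaban1985BackgroundPropagators, (3.50) p.400 (shape)] -/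
def gacoef (η : ℝ) (A : J → X → ℝ) : J → X → ℝ := fun μ x => η * phi1 η (A μ x)

/-- SUP LETTER of `c`: `|c| ≤ |J|·e·r ≤ (1 + |J|)·e·r`. [folklore] -/
theorem abs_gcoef_le {η₀ r η : ℝ} (hreg : η₀ * r ≤ 1) (hr : 0 ≤ r) (hη0 : 0 ≤ η) (hη : η ≤ η₀) {A : J → X → ℝ} (hA : ∀ μ x, |A μ x| ≤ r) (x : X) :
    |gcoef η A x| ≤ (1 + Fintype.card J) * (Real.exp 1 * r) := by
  unfold gcoef
  have hterm : ∀ μ, |phi1 η (A μ x)| ≤ Real.exp 1 * r := fun μ =>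
    (abs_phi1_le hreg hr hη0 hη (hA μ x)).trans (mul_le_mul_of_nonneg_left (hA μ x) (Real.exp_nonneg _))
  calc |∑ μ, phi1 η (A μ x)| ≤ ∑ μ, |phi1 η (A μ x)| := Finset.abs_sum_le_sum_abs _ _
    _ ≤ ∑ _μ : J, Real.exp 1 * r := Finset.sum_le_sum fun μ _ => hterm μ
    _ = Fintype.card J * (Real.exp 1 * r) := by rw [Finset.sum_const, Finset.card_univ, nsmul_eq_mul]
    _ ≤ (1 + Fintype.card J) * (Real.exp 1 * r) := by nlinarith [Real.exp_nonneg (1 : ℝ)]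

/-- SUP LETTER of `a_μ`: `|a_μ| ≤ η·e·r ≤ (1 + |J|)·e·r` for `η ≤ 1`. [folklore] -/
theorem abs_gacoef_le {η₀ r η : ℝ} (hreg : η₀ * r ≤ 1) (hr : 0 ≤ r) (hη0 : 0 ≤ η) (hη : η ≤ η₀) (hη1 : η ≤ 1) {A : J → X → ℝ}
    (hA : ∀ μ x, |A μ x| ≤ r) (μ : J) (x : X) : |gacoef η A μ x| ≤ (1 + Fintype.card J) * (Real.exp 1 * r) := by
  unfold gacoef
  have h1 : |phi1 η (A μ x)| ≤ Real.exp 1 * r :=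
    (abs_phi1_le hreg hr hη0 hη (hA μ x)).trans (mul_le_mul_of_nonneg_left (hA μ x) (Real.exp_nonneg _))
  have hJ : (1 : ℝ) ≤ 1 + Fintype.card J := le_add_of_nonneg_right (Nat.cast_nonneg _)
  rw [abs_mul, abs_of_nonneg hη0]
  calc η * |phi1 η (A μ x)| ≤ 1 * (Real.exp 1 * r) := mul_le_mul hη1 h1 (abs_nonneg _) zero_le_one
    _ ≤ (1 + Fintype.card J) * (Real.exp 1 * r) := mul_le_mul_of_nonneg_right hJ (by positivity)

variable [Fintype X'] [DecidableEq X]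

omit [Fintype X'] [DecidableEq X] in
/-- FIT LETTER of `c`: with the gauge-field fit `|A′_μ − Ā_μ∘π| ≤ o` (e.g. `Ā = blockAvg`, `o` = the oscillation letter) and spacings `0 ≤ η′ ≤ η ≤ η₀`, `η₀r ≤ 1`:
`|c′(x′) − c̄(πx′)| ≤ |J|·(e·o + 2r²η)` (`fit_nonlinear` per direction). [folklore] -/
theorem fit_gcoef (π : X' → X) {η₀ r η η' o : ℝ} (hreg : η₀ * r ≤ 1) (hη' : 0 ≤ η') (hη'η : η' ≤ η) (hη : η ≤ η₀)
    {A' : J → X' → ℝ} {A : J → X → ℝ} (hA' : ∀ μ x', |A' μ x'| ≤ r) (hA : ∀ μ x, |A μ x| ≤ r) (hfit : ∀ μ x', |A' μ x' - A μ (π x')| ≤ o) (x' : X') :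
    |gcoef η' A' x' - gcoef η A (π x')| ≤ Fintype.card J * (Real.exp 1 * o + 2 * r ^ 2 * η) := by
  unfold gcoef
  have hterm : ∀ μ, |phi1 η' (A' μ x') - phi1 η (A μ (π x'))| ≤ Real.exp 1 * o + 2 * r ^ 2 * η := fun μ =>
    fit_nonlinear π phi1 (Real.exp_nonneg 1) (sq_nonneg r) (phi1_lipschitz hreg) (phi1_consistency hreg) hη' hη'η hη (hA' μ) (hA μ)
      (o := fun _ => o) (fun x' => hfit μ x') x'
  rw [← Finset.sum_sub_distrib]
  calc |∑ μ, (phi1 η' (A' μ x') - phi1 η (A μ (π x')))| ≤ ∑ μ, |phi1 η' (A' μ x') - phi1 η (A μ (π x'))| := Finset.abs_sum_le_sum_abs _ _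
    _ ≤ ∑ _μ : J, (Real.exp 1 * o + 2 * r ^ 2 * η) := Finset.sum_le_sum fun μ _ => hterm μ
    _ = Fintype.card J * (Real.exp 1 * o + 2 * r ^ 2 * η) := by rw [Finset.sum_const, Finset.card_univ, nsmul_eq_mul]

omit [Fintype J] [Fintype X'] [DecidableEq X] in
/-- FIT LETTER of `a_μ`: `|a′_μ(x′) − ā_μ(πx′)| ≤ η(e·o + 2r²η) + (η − η′)·e·r` — the species fit plus the spacing inside `R − 1 = η·phi1`. [folklore] -/
theorem fit_gacoef (π : X' → X) {η₀ r η η' o : ℝ} (hreg : η₀ * r ≤ 1) (hr : 0 ≤ r) (hη' : 0 ≤ η') (hη'η : η' ≤ η) (hη : η ≤ η₀)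
    {A' : J → X' → ℝ} {A : J → X → ℝ} (hA' : ∀ μ x', |A' μ x'| ≤ r) (hA : ∀ μ x, |A μ x| ≤ r) (hfit : ∀ μ x', |A' μ x' - A μ (π x')| ≤ o) (μ : J) (x' : X') :
    |gacoef η' A' μ x' - gacoef η A μ (π x')| ≤ η * (Real.exp 1 * o + 2 * r ^ 2 * η) + (η - η') * (Real.exp 1 * r) := by
  unfold gacoef
  have h1 : |phi1 η' (A' μ x') - phi1 η (A μ (π x'))| ≤ Real.exp 1 * o + 2 * r ^ 2 * η :=
    fit_nonlinear π phi1 (Real.exp_nonneg 1) (sq_nonneg r) (phi1_lipschitz hreg) (phi1_consistency hreg) hη' hη'η hη (hA' μ) (hA μ)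
      (o := fun _ => o) (fun x' => hfit μ x') x'
  have h2 : |phi1 η (A μ (π x'))| ≤ Real.exp 1 * r :=
    (abs_phi1_le hreg hr (hη'.trans hη'η) hη (hA μ _)).trans (mul_le_mul_of_nonneg_left (hA μ _) (Real.exp_nonneg _))
  have hsplit : η' * phi1 η' (A' μ x') - η * phi1 η (A μ (π x')) =
      η' * (phi1 η' (A' μ x') - phi1 η (A μ (π x'))) - (η - η') * phi1 η (A μ (π x')) := by ring
  rw [hsplit]
  calc |η' * (phi1 η' (A' μ x') - phi1 η (A μ (π x'))) - (η - η') * phi1 η (A μ (π x'))|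
      ≤ |η' * (phi1 η' (A' μ x') - phi1 η (A μ (π x')))| + |(η - η') * phi1 η (A μ (π x'))| := abs_sub _ _
    _ = η' * |phi1 η' (A' μ x') - phi1 η (A μ (π x'))| + (η - η') * |phi1 η (A μ (π x'))| := by
        rw [abs_mul, abs_mul, abs_of_nonneg hη', abs_of_nonneg (by linarith : 0 ≤ η - η')]
    _ ≤ η * (Real.exp 1 * o + 2 * r ^ 2 * η) + (η - η') * (Real.exp 1 * r) :=
        add_le_add (mul_le_mul hη'η h1 (abs_nonneg _) (hη'.trans hη'η)) (mul_le_mul_of_nonneg_left h2 (by linarith))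

end Species

/-! ## §2 The gauge-field carrier, the pairing, the instances -/

section Carrier

variable {X X' : Type} (J : Type)

/-- THE GAUGE-FIELD BACKGROUND CARRIER (abelian scalar model): configurations are fine gauge fields `A′ : J → X′ → ℝ` (one component per direction; `U′ = e^{iη′A′}`),
`one := 0`, `mul := (+)`, and `Reg335 c α₀ A′` = THE (3.35) LETTER PAIR on every component: `|A′_μ| ≤ c·M·α₀` and `FibreOsc π A′_μ (c·M·α₀·θ)`; `Reg336` repeats it;
(3.37)–(3.38) inert. [cite: Balaban1985BackgroundPropagators, (3.35) p.396 («|A| < O(1)Mα₀(L^jη)^{−1}, |∇^ηA| < O(1)Mα₀(L^jη)^{−2} on □»: shape)] -/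
def gaugeBg (π : X' → X) (M θ : ℝ) : B9.Backgrounds where
  Cfg := J → X' → ℝ
  one := 0
  mul := fun A₁ A₂ => A₁ + A₂
  Reg335 := fun c α₀ A' => (∀ μ x', |A' μ x'| ≤ c * M * α₀) ∧ ∀ μ, FibreOsc π (A' μ) (fun _ => c * M * α₀ * θ)
  Reg336 := fun c α₀ A' => (∀ μ x', |A' μ x'| ≤ c * M * α₀) ∧ ∀ μ, FibreOsc π (A' μ) (fun _ => c * M * α₀ * θ)
  Cplx337 := fun _ _ _ => True
  Cplx338 := fun _ _ _ => True

/-- Unfolding of the carrier's (3.35). [folklore] -/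
theorem reg335_gaugeBg_iff (π : X' → X) (M θ c α₀ : ℝ) (A' : J → X' → ℝ) :
    (gaugeBg J π M θ).Reg335 c α₀ A' ↔ (∀ μ x', |A' μ x'| ≤ c * M * α₀) ∧ ∀ μ, FibreOsc π (A' μ) (fun _ => c * M * α₀ * θ) := Iff.rfl

variable [Fintype X'] [DecidableEq X]

/-- THE TRANSPORT of the gauge field: block average of every component (linearised (C3)). [folklore] -/
def gavg (π : X' → X) (A' : J → X' → ℝ) : J → X → ℝ := fun μ => blockAvg π (A' μ)

/-- `avg_one`. [folklore] -/
theorem gavg_zero (π : X' → X) : gavg J π (0 : J → X' → ℝ) = 0 := funext fun _ => blockAvg_zero π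

variable {g : B6.Geometry} [Fintype X]

/-- THE η-PAIRING over the gauge-field carriers (NOT PRINTED data): scale shift `n`, identity on sites, pull-back of test functions, block-averaged gauge field.
[cite: King1986, p.664 (convention before Prop. 3.8)] -/
def gaugePairing (blk : X → g.Site) (π : X' → X) (n : ℕ) (hL : g.L ≠ 0) (θc θ : ℝ) :
    EtaPairing (opGeo g X blk) (fineGeo g X' (blk ∘ π) n) (gaugeBg J (fun x : X => x) g.M θc) (gaugeBg J π g.M θ) where
  n := n
  k_eq := rfl
  L_eq := rfl
  M_eq := rfl
  eta_eq := by
    show g.eta * (g.L ^ n)⁻¹ * g.L ^ n = g.eta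
    rw [mul_assoc, inv_mul_cancel₀ (pow_ne_zero _ hL), mul_one]
  ι := fun y => y
  scale_ι := fun _ => rfl
  dist_ι := fun _ _ => rfl
  τ := fun lam => pull π lam
  suppIn_τ := fun _ _ h x' hx' => h (π x') hx'
  supNorm_τ := fun lam => by
    show (⨆ x' : X', |lam (π x')|) ≤ ⨆ x : X, |lam x|
    exact Real.iSup_le (fun x' => abs_le_iSup_abs lam (π x')) (Real.iSup_nonneg fun x => abs_nonneg _)
  avg := gavg J π
  avg_one := gavg_zero J π

/-- THE REALISED PAIRED INSTANCE over the gauge-field carriers. [cite: Balaban1985BackgroundPropagators, Thm 3.14 pp.426–427 (typing template)] -/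
def gaugeInstance (blk : X → g.Site) (π : X' → X) (n : ℕ) (hL : g.L ≠ 0) (θc θ : ℝ) : PairedInstance :=
  ⟨opGeo g X blk, fineGeo g X' (blk ∘ π) n, gaugeBg J (fun x : X => x) g.M θc, gaugeBg J π g.M θ, gaugePairing J blk π n hL θc θ⟩

/-- THE GUARD IS LIVE: the fine geometry's [B9] size parameter is the datum's `M`. [folklore] -/
theorem gaugeInstance_M (blk : X → g.Site) (π : X' → X) (n : ℕ) (hL : g.L ≠ 0) (θc θ : ℝ) : (gaugeInstance J blk π n hL θc θ).gf.M = g.M := rfl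

end Carrier

/-! ## §3 The perturbation letters of the derived coefficients, read off `Reg335` under the guard -/

section Letters

variable {X X' J : Type} [Fintype X] [Fintype X'] [Fintype J] [DecidableEq X] {g : B6.Geometry} (blk : X → g.Site) (π : X' → X)

/-- **THE PERTURBATION LETTERS FROM THE GAUGE FIELD's (3.35).**  Spacings `0 ≤ η′ ≤ η ≤ 1`, `η ≤ θ` (the rate number dominates the spacing); guard `c₃₅ > 0`, `M ≥ 1`, `α₀ > 0`, `M·α₀ ≤ a₀`, `c₃₅a₀ ≤ 1` (so
`ηr ≤ 1` for `r = c₃₅Mα₀`); `(gaugeBg J π M θ).Reg335 c₃₅ α₀ A′`.  Then with the ONE letter `r₁ = (2e + 2)(1 + |J|)·r`: the unstacked perturbations of the DERIVED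
coefficients — fine `(gcoef η′ A′, gacoef η′ A′)`, coarse `(gcoef η Ā, gacoef η Ā)`, `Ā = gavg A′` — have majorants `diagK (r₁(1+|J|))` and the diagonal η-defect
`diagK (r₁θ(1+|J|))`; and `0 ≤ r₁ ≤ (2e+2)(1+|J|)·c₃₅·a₀`. [cite: Balaban1985BackgroundPropagators, Thm 3.1 p.397 (quantifier template); (3.35) p.396, (3.50) p.400 (shapes)] -/
theorem gauge_letters_of_reg335 {η η' θ c35 a₀ M α₀ : ℝ} (hη' : 0 ≤ η') (hη'η : η' ≤ η) (hη1 : η ≤ 1) (hηθ : η ≤ θ) (hc35 : 0 < c35)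
    (hM : 1 ≤ M) (hα₀ : 0 < α₀) (hMα : M * α₀ ≤ a₀) (ha₀1 : c35 * a₀ ≤ 1) {A' : J → X' → ℝ} (hreg : (gaugeBg J π M θ).Reg335 c35 α₀ A') :
    0 ≤ (2 * Real.exp 1 + 2) * (1 + Fintype.card J) * (c35 * M * α₀) ∧
      (2 * Real.exp 1 + 2) * (1 + Fintype.card J) * (c35 * M * α₀) ≤ (2 * Real.exp 1 + 2) * (1 + Fintype.card J) * c35 * a₀ ∧
      HasMaj (BlockNorm.ofBlocks g (blkPair blk)) (BlockNorm.ofBlocks g blk) (unstack (gcoef η (gavg J π A')) (gacoef η (gavg J π A')))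
        (diagK fun _ => (2 * Real.exp 1 + 2) * (1 + Fintype.card J) * (c35 * M * α₀) * (1 + Fintype.card J)) ∧
      HasMaj (BlockNorm.ofBlocks g (blkPair (blk ∘ π))) (BlockNorm.ofBlocks g (blk ∘ π)) (unstack (gcoef η' A') (gacoef η' A'))
        (diagK fun _ => (2 * Real.exp 1 + 2) * (1 + Fintype.card J) * (c35 * M * α₀) * (1 + Fintype.card J)) ∧
      HasMaj (BlockNorm.ofBlocks g (blkPair blk)) (BlockNorm.ofBlocks g (blk ∘ π))
        (idef (pull (liftPair π)) (pull π) (unstack (gcoef η' A') (gacoef η' A')) (unstack (gcoef η (gavg J π A')) (gacoef η (gavg J π A'))))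
        (diagK fun _ => (2 * Real.exp 1 + 2) * (1 + Fintype.card J) * (c35 * M * α₀) * θ * (1 + Fintype.card J)) := by
  obtain ⟨hsup, hosc⟩ := (reg335_gaugeBg_iff J π M θ c35 α₀ A').1 hreg
  set r : ℝ := c35 * M * α₀ with hr_def
  have he : (1 : ℝ) ≤ Real.exp 1 := by have := Real.add_one_le_exp (1 : ℝ); linarith
  have hJ0 : (0 : ℝ) ≤ 1 + Fintype.card J := by positivity
  have hJ1 : (1 : ℝ) ≤ 1 + Fintype.card J := le_add_of_nonneg_right (Nat.cast_nonneg _)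
  have hM0 : 0 ≤ M := zero_le_one.trans hM
  have hr0 : 0 ≤ r := by positivity
  have hra : r ≤ c35 * a₀ := by rw [hr_def, mul_assoc]; exact mul_le_mul_of_nonneg_left hMα hc35.le
  have hr1 : r ≤ 1 := hra.trans ha₀1
  have hreg1 : (1 : ℝ) * r ≤ 1 := by rw [one_mul]; exact hr1
  have hη0 : 0 ≤ η := hη'.trans hη'η
  have hθ0 : 0 ≤ θ := hη0.trans hηθ
  -- coarse gauge field: block averages keep the sup letter; fit from the oscillation letter
  have hAbar : ∀ μ x, |gavg J π A' μ x| ≤ r := fun μ => abs_blockAvg_le π hr0 (hsup μ)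
  have hfitA : ∀ μ x', |A' μ x' - gavg J π A' μ (π x')| ≤ r * θ := fun μ x' => fit_blockAvg π (hosc μ) x'
  -- sup letters of the derived coefficients (both spacings)
  set r₁ : ℝ := (2 * Real.exp 1 + 2) * (1 + Fintype.card J) * r with hr₁_def
  have he2 : Real.exp 1 ≤ 2 * Real.exp 1 + 2 := by linarith [Real.exp_nonneg (1 : ℝ)]
  have hsmall : (1 + Fintype.card J) * (Real.exp 1 * r) ≤ r₁ := by
    calc (1 + Fintype.card J) * (Real.exp 1 * r) = Real.exp 1 * ((1 + Fintype.card J) * r) := by ring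
      _ ≤ (2 * Real.exp 1 + 2) * ((1 + Fintype.card J) * r) := mul_le_mul_of_nonneg_right he2 (mul_nonneg hJ0 hr0)
      _ = r₁ := by rw [hr₁_def]; ring
  have hc' : ∀ x', |gcoef η' A' x'| ≤ r₁ := fun x' => (abs_gcoef_le hreg1 hr0 hη' (hη'η.trans hη1) hsup x').trans hsmall
  have ha' : ∀ μ x', |gacoef η' A' μ x'| ≤ r₁ := fun μ x' =>
    (abs_gacoef_le hreg1 hr0 hη' (hη'η.trans hη1) (hη'η.trans hη1) hsup μ x').trans hsmall
  have hc : ∀ x, |gcoef η (gavg J π A') x| ≤ r₁ := fun x => (abs_gcoef_le hreg1 hr0 hη0 hη1 hAbar x).trans hsmall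
  have ha : ∀ μ x, |gacoef η (gavg J π A') μ x| ≤ r₁ := fun μ x => (abs_gacoef_le hreg1 hr0 hη0 hη1 hη1 hAbar μ x).trans hsmall
  -- fit letters of the derived coefficients, dominated by `r₁·θ` (`η ≤ θ ≤ 1`, `r ≤ 1`)
  have hfc0 := fit_gcoef (J := J) π hreg1 hη' hη'η hη1 hsup hAbar hfitA
  have hfa0 := fit_gacoef (J := J) π hreg1 hr0 hη' hη'η hη1 hsup hAbar hfitA
  have hr2 : r ^ 2 * η ≤ r * θ := by
    calc r ^ 2 * η = r * (r * η) := by ring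
      _ ≤ r * (1 * θ) := mul_le_mul_of_nonneg_left (mul_le_mul hr1 hηθ hη0 zero_le_one) hr0
      _ = r * θ := by ring
  have hkey1 : Real.exp 1 * (r * θ) + 2 * r ^ 2 * η ≤ (Real.exp 1 + 2) * r * θ := by nlinarith [hr2]
  have hfc : ∀ x', |gcoef η' A' x' - gcoef η (gavg J π A') (π x')| ≤ r₁ * θ := fun x' => by
    refine (hfc0 x').trans ?_
    have hcardJ : (Fintype.card J : ℝ) ≤ 1 + Fintype.card J := by linarith
    calc (Fintype.card J : ℝ) * (Real.exp 1 * (r * θ) + 2 * r ^ 2 * η) ≤ (1 + Fintype.card J) * ((Real.exp 1 + 2) * r * θ) :=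
          mul_le_mul hcardJ hkey1 (by positivity) hJ0
      _ = (Real.exp 1 + 2) * ((1 + Fintype.card J) * r * θ) := by ring
      _ ≤ (2 * Real.exp 1 + 2) * ((1 + Fintype.card J) * r * θ) :=
          mul_le_mul_of_nonneg_right (by linarith [Real.exp_nonneg (1 : ℝ)]) (by positivity)
      _ = r₁ * θ := by rw [hr₁_def]; ring
  have hfa : ∀ μ x', |gacoef η' A' μ x' - gacoef η (gavg J π A') μ (π x')| ≤ r₁ * θ := fun μ x' => by
    refine (hfa0 μ x').trans ?_
    have h1 : η * (Real.exp 1 * (r * θ) + 2 * r ^ 2 * η) ≤ (Real.exp 1 + 2) * r * θ := by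
      calc η * (Real.exp 1 * (r * θ) + 2 * r ^ 2 * η) ≤ 1 * ((Real.exp 1 + 2) * r * θ) :=
            mul_le_mul hη1 hkey1 (by positivity) zero_le_one
        _ = (Real.exp 1 + 2) * r * θ := one_mul _
    have h2 : (η - η') * (Real.exp 1 * r) ≤ Real.exp 1 * r * θ := by
      calc (η - η') * (Real.exp 1 * r) ≤ θ * (Real.exp 1 * r) := mul_le_mul_of_nonneg_right (by linarith) (by positivity)
        _ = Real.exp 1 * r * θ := by ring
    calc η * (Real.exp 1 * (r * θ) + 2 * r ^ 2 * η) + (η - η') * (Real.exp 1 * r) ≤ (Real.exp 1 + 2) * r * θ + Real.exp 1 * r * θ := add_le_add h1 h2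
      _ = (2 * Real.exp 1 + 2) * 1 * (r * θ) := by ring
      _ ≤ (2 * Real.exp 1 + 2) * (1 + Fintype.card J) * (r * θ) :=
          mul_le_mul_of_nonneg_right (mul_le_mul_of_nonneg_left hJ1 (by positivity)) (mul_nonneg hr0 hθ0)
      _ = r₁ * θ := by rw [hr₁_def]; ring
  have hr₁0 : 0 ≤ r₁ := by positivity
  have hr₁a : r₁ ≤ (2 * Real.exp 1 + 2) * (1 + Fintype.card J) * c35 * a₀ := by
    rw [hr₁_def]
    calc (2 * Real.exp 1 + 2) * (1 + Fintype.card J) * r ≤ (2 * Real.exp 1 + 2) * (1 + Fintype.card J) * (c35 * a₀) :=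
          mul_le_mul_of_nonneg_left hra (by positivity)
      _ = _ := by ring
  refine ⟨hr₁0, hr₁a, hasMaj_unstack blk hr₁0 hc ha, hasMaj_unstack (blk ∘ π) hr₁0 hc' ha', ?_⟩
  have h := hasMaj_idef_unstack blk π (mul_nonneg hr₁0 hθ0) hfc hfa
  exact h

end Letters

end Summit.QuantumFields.YangMills.BalabanUVNodes.N15.BackgroundLayer
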